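import Literature.Claims.NS.Wu2026
import Literature.Analysis.FunctionSpaces.WeakLpQuantitative
import Mathlib.MeasureTheory.Measure.Lebesgue.EqHaar
import HarnessLib

/-!
# C177 `Wu2026` — SALVAGE, TRUE column: the Seregin–Wang half of Lemma 2.1 PROVED —
# finite Dirichlet energy from `v ∈ L^{9/2,∞}` (D-0090 NS-CLAIMS, LADDER row rung 3; salvage seat
# `ns-claims-salvage-p3`)

The first consumed binder of `Literature.Claims.NS.Wu2026.claim_of_steps''`, `Step_L21` (Lemma 2.1 p.5
l.30–52 = the text's «Theorem 2.1»), asserts for every smooth steady flow of the class: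
(2.3) `v ∈ L^{9/2,∞}(ℝ³)` (endpoint Biot–Savart + Lorentz HLS) AND (2.4) `D(v) < ∞`. The print proves
(2.4) from (2.3) by the annular estimate (2.5)–(2.6) and «[15, Theorem 1.1(i)]» = Seregin–Wang 2020,
which the tree PROVES (`Literature.Analysis.FluidPDE.SereginWang2020_annular_liouville_holds`, Lebesgue
instance `q = ℓ`). This file ports exactly that second half:

* `annularMorrey_four_le` — for `v ∈ L^{9/2,∞}`, the Seregin–Wang quantity at `q = 4`,
  `M(R) = R^{2/3−3/4}‖v‖_{L⁴(B_R∖B_{R/2})}`, is bounded by `(|B₁| + 8‖v‖^{9/2}_{L^{9/2,∞}})^{1/4}` for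
  every `R > 0` (quantitative layer cake `MemWeakLp.setLIntegral_rpow_le` at height `R^{−2/3}`);
* `dirichlet_lt_top_of_memWeakLp` — hence `liminf_R M(R) < ∞` and, by Seregin–Wang (i),
  `D(v) = ∫|∇v|² < ∞` for every `IsWuFlow` with `v ∈ L^{9/2,∞}`;
* `step_L21_of_weakHLS` — so `Step_L21` reduces to its weak-HLS half (2.3), the only part of Lemma 2.1
  not ported (no weak-Lorentz Hardy–Littlewood–Sobolev / endpoint Biot–Savart theorem in the tree).

Standard axioms; no definition. Companions: `SoloSalvageWu2026{,Flux,Annulus,LogMass,Reduced}.lean`.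

WHAT THIS IS NOT: not a claim about NS regularity or blow-up; not a claim about any author beyond the
typed locator.
-/

noncomputable section

set_option linter.dupNamespace false

open MeasureTheory Set Function Filter Topology Metric
open scoped ENNReal NNReal RealInnerProductSpace

namespace Summit.NavierStokesRegularity.NavierStokesRegularity.Theorems.Wu2026Salvage

open Literature.Analysis.FluidPDE Literature.Analysis.FunctionSpaces Literature.Claims.NS.Wu2026

/-- **The Seregin–Wang annular quantity of a weak-`L^{9/2}` field is bounded** ((2.5)–(2.6) of the proof
of Lemma 2.1 p.5 l.57 – p.6 l.30, at `q = 4`): for `v ∈ L^{9/2,∞}(ℝ³)`, `M_{2/3,4,4}(R) = R^{2/3−3/4}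
‖v‖_{L⁴(B_R∖B_{R/2})} ≤ (|B₁| + 8‖v‖^{9/2}_{L^{9/2,∞}})^{1/4}` for every `R > 0` (layer cake at height
`R^{−2/3}`, tree `MemWeakLp.setLIntegral_rpow_le`). [cite: Wu2026, Lemma 2.1 proof (2.5)–(2.6) p.5 l.57 – p.6 l.30] -/
theorem annularMorrey_four_le {v : E3 → E3} (hv : MemWeakLp v ((9 : ℝ≥0∞) / 2) volume) {R : ℝ}
    (hR : 0 < R) :
    annularMorrey 4 v R ≤ (volume (ball (0 : E3) 1) + ENNReal.ofReal 8 *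
      eWeakLpPow v ((9 : ℝ≥0∞) / 2) volume) ^ ((1 : ℝ) / 4) := by
  set W : ℝ≥0∞ := eWeakLpPow v ((9 : ℝ≥0∞) / 2) volume with hW
  set V1 : ℝ≥0∞ := volume (ball (0 : E3) 1) with hV1
  set S : Set E3 := ball (0 : E3) R \ ball (0 : E3) (R / 2) with hS
  have hP : (((9 : ℝ≥0∞) / 2).toReal) = 9 / 2 := by rw [ENNReal.toReal_div]; norm_num
  -- the layer-cake bound at height `λ = R^{-2/3}`
  set lam : ℝ := R ^ (-(2 : ℝ) / 3) with hlam
  have hlam0 : 0 < lam := Real.rpow_pos_of_pos hR _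
  have hbound := MemWeakLp.setLIntegral_rpow_le (μ := volume) (p := (9 : ℝ≥0∞) / 2) hv.1
    (r := 4) (by norm_num) (by rw [hP]; norm_num) S hlam0
  rw [hP, ← hW] at hbound
  -- powers of `R`
  have hlam4 : lam ^ (4 : ℝ) = R ^ (-(8 : ℝ) / 3) := by
    rw [hlam, ← Real.rpow_mul hR.le]; norm_num
  have hlamq : lam ^ ((4 : ℝ) - 9 / 2) = R ^ ((1 : ℝ) / 3) := by
    rw [hlam, ← Real.rpow_mul hR.le]; norm_num
  have hR3 : R ^ 3 * R ^ (-(8 : ℝ) / 3) = R ^ ((1 : ℝ) / 3) := by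
    rw [← Real.rpow_natCast R 3, ← Real.rpow_add hR]; norm_num
  have hvolS : volume S ≤ ENNReal.ofReal (R ^ 3) * V1 := by
    calc volume S ≤ volume (ball (0 : E3) R) := measure_mono sdiff_subset
      _ = ENNReal.ofReal (R ^ Module.finrank ℝ E3) * V1 := Measure.addHaar_ball_of_pos volume _ hR
      _ = ENNReal.ofReal (R ^ 3) * V1 := by rw [finrank_euclideanSpace, Fintype.card_fin]
  -- `∫_S |v|^4 ≤ R^{1/3} (V1 + 8 W)`
  have hI : ∫⁻ x in S, ‖v x‖ₑ ^ (4 : ℝ) ≤ ENNReal.ofReal (R ^ ((1 : ℝ) / 3)) * (V1 + ENNReal.ofReal 8 * W) := by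
    refine hbound.trans ?_
    have h1 : volume S * ENNReal.ofReal (lam ^ (4 : ℝ)) ≤ ENNReal.ofReal (R ^ ((1 : ℝ) / 3)) * V1 := by
      calc volume S * ENNReal.ofReal (lam ^ (4 : ℝ))
          ≤ ENNReal.ofReal (R ^ 3) * V1 * ENNReal.ofReal (lam ^ (4 : ℝ)) := mul_le_mul' hvolS le_rfl
        _ = ENNReal.ofReal (R ^ 3 * lam ^ (4 : ℝ)) * V1 := by
            rw [ENNReal.ofReal_mul (by positivity)]; ring
        _ = ENNReal.ofReal (R ^ ((1 : ℝ) / 3)) * V1 := by rw [hlam4, hR3]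
    have h2 : ENNReal.ofReal (4 / (9 / 2 - 4) * lam ^ ((4 : ℝ) - 9 / 2)) * W =
        ENNReal.ofReal (R ^ ((1 : ℝ) / 3)) * (ENNReal.ofReal 8 * W) := by
      rw [hlamq, show (4 : ℝ) / (9 / 2 - 4) = 8 by norm_num, ENNReal.ofReal_mul (by norm_num)]
      ring
    calc volume S * ENNReal.ofReal (lam ^ (4 : ℝ)) + ENNReal.ofReal (4 / (9 / 2 - 4) * lam ^ ((4 : ℝ) - 9 / 2)) * W
        ≤ ENNReal.ofReal (R ^ ((1 : ℝ) / 3)) * V1 + ENNReal.ofReal (R ^ ((1 : ℝ) / 3)) * (ENNReal.ofReal 8 * W) := by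
          rw [h2]; exact add_le_add h1 le_rfl
      _ = ENNReal.ofReal (R ^ ((1 : ℝ) / 3)) * (V1 + ENNReal.ofReal 8 * W) := by ring
  -- take the fourth root and multiply by `R^{2/3 − 3/4} = R^{−1/12}`
  have hroot : (∫⁻ x in S, ‖v x‖ₑ ^ (4 : ℝ)) ^ ((1 : ℝ) / 4) ≤
      ENNReal.ofReal (R ^ ((1 : ℝ) / 12)) * (V1 + ENNReal.ofReal 8 * W) ^ ((1 : ℝ) / 4) := by
    calc (∫⁻ x in S, ‖v x‖ₑ ^ (4 : ℝ)) ^ ((1 : ℝ) / 4)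
        ≤ (ENNReal.ofReal (R ^ ((1 : ℝ) / 3)) * (V1 + ENNReal.ofReal 8 * W)) ^ ((1 : ℝ) / 4) :=
          ENNReal.rpow_le_rpow hI (by norm_num)
      _ = ENNReal.ofReal (R ^ ((1 : ℝ) / 12)) * (V1 + ENNReal.ofReal 8 * W) ^ ((1 : ℝ) / 4) := by
          rw [ENNReal.mul_rpow_of_nonneg _ _ (by norm_num),
            ENNReal.ofReal_rpow_of_nonneg (by positivity) (by norm_num), ← Real.rpow_mul hR.le]
          norm_num
  unfold annularMorrey
  rw [← hS]
  calc ENNReal.ofReal (R ^ ((2 : ℝ) / 3 - 3 / 4)) * (∫⁻ x in S, ‖v x‖ₑ ^ (4 : ℝ)) ^ ((1 : ℝ) / 4)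
      ≤ ENNReal.ofReal (R ^ ((2 : ℝ) / 3 - 3 / 4)) *
          (ENNReal.ofReal (R ^ ((1 : ℝ) / 12)) * (V1 + ENNReal.ofReal 8 * W) ^ ((1 : ℝ) / 4)) :=
        mul_le_mul' le_rfl hroot
    _ = (V1 + ENNReal.ofReal 8 * W) ^ ((1 : ℝ) / 4) := by
        rw [← mul_assoc, ← ENNReal.ofReal_mul (by positivity), ← Real.rpow_add hR,
          show (2 : ℝ) / 3 - 3 / 4 + 1 / 12 = 0 by norm_num, Real.rpow_zero, ENNReal.ofReal_one, one_mul]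

/-- **Lemma 2.1, final step (2.4) PROVED from its first half: finite Dirichlet energy from
`v ∈ L^{9/2,∞}` by Seregin–Wang** (p.5 l.50–52 «D(v) := ∫|∇v|² dx ≤ C‖ω‖³…»; p.6 l.63–77 «The final
step … is exactly [15, Theorem 1.1(i)]», tree `SereginWang2020_annular_liouville_holds` in the Lebesgue
instance `q = ℓ = 4`): for a smooth steady flow with `v ∈ L^{9/2,∞}(ℝ³)` the annular Morrey quantity is
bounded (`annularMorrey_four_le`), hence `liminf_R M(R) < ∞` and `D(v) < ∞`.
[cite: Wu2026, Lemma 2.1 (2.4) p.5 l.50–52; proof p.6 l.63–77] [cite: SereginWang2020, Thm 1.1 (i)] -/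
theorem dirichlet_lt_top_of_memWeakLp {ν : ℝ} (hν : 0 < ν) {v : E3 → E3} {p : E3 → ℝ}
    (hflow : IsWuFlow ν v p) (hv : MemWeakLp v ((9 : ℝ≥0∞) / 2) volume) : dirichlet v < ∞ := by
  set K : ℝ≥0∞ := (volume (ball (0 : E3) 1) + ENNReal.ofReal 8 *
    eWeakLpPow v ((9 : ℝ≥0∞) / 2) volume) ^ ((1 : ℝ) / 4) with hK
  have hKfin : K < ∞ := by
    refine ENNReal.rpow_lt_top_of_nonneg (by norm_num) ?_
    exact ENNReal.add_ne_top.2 ⟨measure_ball_lt_top.ne,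
      ENNReal.mul_ne_top ENNReal.ofReal_ne_top hv.2.ne⟩
  have hlim : liminf (annularMorrey 4 v) atTop ≤ K :=
    liminf_le_of_frequently_le'
      (((eventually_gt_atTop (0 : ℝ)).mono fun R hR => annularMorrey_four_le hv hR).frequently)
  have hlimfin : liminf (annularMorrey 4 v) atTop < ∞ := lt_of_le_of_lt hlim hKfin
  obtain ⟨c, _hc, hSW⟩ := SereginWang2020_annular_liouville_holds ν hν 4 (by norm_num)
  have hD := (hSW v p hflow.profile hflow.smooth_v hflow.smooth_p hlimfin).1
  refine lt_of_le_of_lt hD ?_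
  exact ENNReal.mul_lt_top ENNReal.ofReal_lt_top (ENNReal.pow_lt_top hlimfin)

/-- **`Step_L21` from its weak-HLS half**: if every `IsWuFlow` has `v ∈ L^{9/2,∞}` ((2.3), endpoint
Biot–Savart + Lorentz HLS — the part of Lemma 2.1 NOT ported), then `Step_L21` holds (the Dirichlet
half (2.4) being `dirichlet_lt_top_of_memWeakLp`). [cite: Wu2026, Lemma 2.1 p.5 l.30–52] -/
theorem step_L21_of_weakHLS
    (hHLS : ∀ ν : ℝ, 0 < ν → ∀ (v : E3 → E3) (p : E3 → ℝ), IsWuFlow ν v p →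
      MemWeakLp v ((9 : ℝ≥0∞) / 2) volume) : Step_L21 :=
  fun ν hν v p hflow => ⟨hHLS ν hν v p hflow, dirichlet_lt_top_of_memWeakLp hν hflow (hHLS ν hν v p hflow)⟩

end Summit.NavierStokesRegularity.NavierStokesRegularity.Theorems.Wu2026Salvage

end

-- WHAT THIS IS NOT: not a claim about NS regularity or blow-up; not a claim about any author beyond the typed locator.
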